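import Mathlib
import HarnessLib
-- buildfix (bf1-g32) B32-12: comment-only touch to re-dispatch the lane build (prune victim: source 08-16, hub olean removed 22:46Z 08-28; deepest olean-less link under ModularForms.SturmCongruenceBoundProofs, reported remote:stale:1435:unbuilt by lit-hodgefound p25 05:09Z (draft LevelOneHeckeSturmGenerators cannot elaborate)); declarations byte-identical

/-!
# Sturm's congruence bound for modular forms on `Γ₁(N)` (named fact)

J. Sturm, *On the congruence of modular forms*, Number theory (New York, 1984–1985), Lecture Notes in
Math. 1240, Springer (1987), 275–280, **Theorem 1**: for a subgroup `Γ` of finite index in `SL₂(ℤ)`, a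
holomorphic modular form `f ∈ M_k(Γ)` whose `q`-expansion coefficients lie in the ring of integers
`𝒪_F` of a number field, and a prime `λ` of `𝒪_F`, if `ord_λ f > k [SL₂(ℤ) : Γ] / 12` (i.e. the
coefficients `a_n(f)`, `n ≤ k[SL₂(ℤ):Γ]/12`, all lie in `λ`) then `f ≡ 0 (mod λ)` (all coefficients lie
in `λ`).  The characteristic-zero shadow (`a_n = 0` for `n ≤ k[SL₂(ℤ):Γ]/12` ⇒ `f = 0`) is PROVED in
the tree (`Literature.NumberTheory.EllipticCurves.ModularForms.modularForm_eq_zero_of_qExpansion_coeff_eq_zero`);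
the congruence statement needs the integrality of the `q`-expansions of the `SL₂(ℤ)`-translates of `f`
at the other cusps (Shimura 1971, Thm. 3.52 / the `q`-expansion principle), which the tree does not
have, so it is recorded here as a NAMED FACT (D-0014), in the special case actually consumed:

* `Sturm1987_congruence_modPrime_gamma1` — `Γ = Γ₁(N)`, coefficients in `ℤ`, `λ = (p)` with `p ∤ N`,
  weight `k : ℤ` (vacuous for `k < 0`, where `M_k(Γ₁(N)) = 0`), Sturm line
  `⌊k · [SL₂(ℤ) : Γ₁(N)] / 12⌋` with Mathlib's `Subgroup.index` of `Γ₁(N) ≤ SL₂(ℤ)` (for `N ≥ 3`,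
  `-1 ∉ Γ₁(N)` and this index is twice the `PSL₂`-index, so the bound used is the cruder, printed one).
* `Sturm1987_congruence_modPrime_gamma1.cuspForm` — its restriction to cusp forms (same statement for
  `f ∈ S_k(Γ₁(N))`), the shape consumed by the two Katz–Sturm lines of route `CapacityClassicality`
  (`Summits/Langlands/Langlands/Cruxes/IntegralOverconvergentIsCongruence/Lines/Sketch.lean`, stub
  `stub_sturmModPrime`; `…/HilbertIntegralOverconvergentIsCongruence/Lines/Sketch_ideate_r1_k1.lean`,
  stub 1′), proved here from the named fact.

Consumers: `Summits/Langlands/Langlands/Theorems/CapacityClassicalityIntegralOverconvergentIsCongruenceStubSupNormOfSturm.lean`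
(sup-norm Sturm along `ι : ℚ̄_p ≃ ℂ` for `S_k(Γ₁(N))`, from this fact + the Deligne–Serre integral span)
and `…HilbertIntegralOverconvergentIsCongruenceShadow.lean`.

-- TODO(general form): finite-index `Γ ∋ T` (any cusp width), coefficients in `𝒪_F`, every prime `λ`
-- of `𝒪_F` including `λ ∣ N`; and the sharper `PSL₂`-index.
-/

namespace Literature.NumberTheory.ModularForms

open scoped MatrixGroups

/-- **Sturm's congruence bound, `Γ₁(N)`, over `ℤ`, at a prime `p ∤ N`** (Sturm 1987, Theorem 1,
special case): if `f ∈ M_k(Γ₁(N))` has rational-integer `q`-expansion coefficients `zₙ` at `∞`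
(period `1`) and `p ∣ zₙ` for every `n ≤ ⌊k · [SL₂(ℤ) : Γ₁(N)] / 12⌋`, then `p ∣ zₙ` for every `n`.
[cite: Sturm1987, Thm 1] -/
def Sturm1987_congruence_modPrime_gamma1 : Prop :=
  ∀ (N : ℕ) [NeZero N] (p : ℕ), p.Prime → ¬ p ∣ N →
    ∀ (k : ℤ) (f : ModularForm (CongruenceSubgroup.Gamma1 N) k) (z : ℕ → ℤ),
      (∀ n : ℕ, PowerSeries.coeff n (UpperHalfPlane.qExpansion 1 ⇑f) = (z n : ℂ)) →
      (∀ n : ℕ, n ≤ (k * ((CongruenceSubgroup.Gamma1 N).index : ℤ)).toNat / 12 → (p : ℤ) ∣ z n) →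
      ∀ n : ℕ, (p : ℤ) ∣ z n

/-- **Sturm's congruence bound for CUSP forms on `Γ₁(N)`** (the case `f ∈ S_k(Γ₁(N)) ⊆ M_k(Γ₁(N))`
of `Sturm1987_congruence_modPrime_gamma1`; a cusp form is a modular form with the same `q`-expansion,
Mathlib's coercion `CuspForm Γ k → ModularForm Γ k`).  This is verbatim the registered stub
`stub_sturmModPrime` of both Katz–Sturm lines of route `CapacityClassicality`. [cite: Sturm1987, Thm 1] -/
theorem Sturm1987_congruence_modPrime_gamma1.cuspForm (h : Sturm1987_congruence_modPrime_gamma1) :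
    ∀ (N : ℕ) [NeZero N] (p : ℕ), p.Prime → ¬ p ∣ N →
      ∀ (k : ℤ) (f : CuspForm (CongruenceSubgroup.Gamma1 N) k) (z : ℕ → ℤ),
        (∀ n : ℕ, PowerSeries.coeff n (UpperHalfPlane.qExpansion 1 ⇑f) = (z n : ℂ)) →
        (∀ n : ℕ, n ≤ (k * ((CongruenceSubgroup.Gamma1 N).index : ℤ)).toNat / 12 → (p : ℤ) ∣ z n) →
        ∀ n : ℕ, (p : ℤ) ∣ z n :=
  fun N _ p hp hpN k f z hz hdiv ↦
    h N p hp hpN k (f : ModularForm (CongruenceSubgroup.Gamma1 N) k) z hz hdiv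

end Literature.NumberTheory.ModularForms
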